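/-
Copyright (c) 2026 the pub-hodgecm-mathlib formalisation cell (harness21).  Prover seat hodgecm-mathlib-K2E1-p12 (g2), Track B ∕ K2-LIT, h413 = `stmt-HodgeConjecture-24833`,
line `K2_E1_TraceFormulaBeta`, (225) FILE γ of the dealer K2E1-plan (g7): the EXISTENCE OF THE `L²` RESIDUE `Res_T = lim_{z → 1} (z − 1)•F_T(z)` of the operator road's truncated
Eisenstein family of `U(1,1)∕CM` from the Maass–Selberg bound (MS-1), and the residue theorem of ★ p860098 with its `(Res, hRes)` letters discharged by (MS-1).
-/
import Summits.HodgeConjecture.HodgeConjecture.Theorems.K2E1SphericalEisensteinResidueCuspidalCMTwo   -- THIS SEAT ★ p860098: `residueValue_eq_const_cm_two`, `exists_analyticAt_remainder_cm_two`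
import Summits.HodgeConjecture.HodgeConjecture.Theorems.K2E1BLRemovablePolesU                     -- ★ p859366: the Banach-valued removable-singularity brick `exists_analyticAt_eventuallyEq_of_differentiableAt_of_eventually_norm_le`
import HarnessLib

/-!
# K2·E1 — `K2E1SphericalEisensteinL2ResidueCMTwo` ((225) FILE γ, `U(1,1)_{L/L⁺}`): THE `L²` RESIDUE `Res_T = lim_{z→1} (z − 1)•F_T(z)` EXISTS AS SOON AS `‖(z − 1)•F_T(z)‖_{L²}` IS
# BOUNDED NEAR `1` (MS-1) — and the residue theorem ★ p860098 with `(Res, hRes)` discharged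

Track B ∕ K2-LIT, crux h413 = `stmt-HodgeConjecture-24833`, route of record `HCCMUnconditional`; cell `hodgecm-mathlib`, squad K2, ENGINE E1.  Prover seat `hodgecm-mathlib-K2E1-p12` (g2);
deal (225) of the dealer K2E1-plan (g7) (the (MS-real)₂ chain: FILE α ★ p860161 → β1 ★ p860181 → β2 → β3 `K2E1SphericalEisensteinL2BoundCMTwo` (pays (MS-1)) → γ = this file).  The
dealer's note «Cauchy in `L²` from the off-diagonal four-term by polarisation … or bounded + weak limit + norm convergence — your call after census»: the census answer is that
NEITHER is needed — an `L²(μ)`-valued function HOLOMORPHIC on a punctured neighbourhood of `1` and BOUNDED there has a removable singularity (Riemann's theorem is Banach-valued in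
Mathlib: `Complex.differentiableOn_update_limUnder_of_bddAbove`; in the tree's currency ★ `K2E1BLRemovablePolesU.exists_analyticAt_eventuallyEq_of_differentiableAt_of_eventually_norm_le`,
stated for any complete normed `ℂ`-space `X`), so `z ↦ (z − 1)•F_T(z)` extends analytically across `1` and in particular CONVERGES.  THEOREMS ONLY (no `def`, no `instance`, no notation,
no named-fact hypothesis, no `sorry`); lane `--supports stmt-HodgeConjecture-24833 --as helper` (count-neutral).  Closes no socket.
* §1 (any complete normed `ℂ`-space `X`, any pole `z₁`) **`exists_tendsto_sub_smul_of_eventually_norm_le`** — `F` differentiable on a punctured neighbourhood of `z₁` and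
  `‖(z − z₁)•F z‖ ≤ C` there ⟹ `∃ Res, (z − z₁)•F z → Res` along `𝓝[≠] z₁`; `exists_tendsto_sub_smul_of_differentiableOn` — the same from `DifferentiableOn ℂ F D` on an open `D`
  containing a punctured neighbourhood of `z₁` (the operator road's shape: `D ⊇ B(1,ρ)∖{1}`).
* §2 (`U(1,1)∕CM`) **`residueValue_eq_const_cm_two_of_ms`** and **`exists_analyticAt_remainder_cm_two_of_ms`** — ★ p860098's two heads with the letters `(Res, hRes)` REPLACED by the
  single Maass–Selberg letter (MS-1) `hMS1 : ∃ C, ∀ᶠ z in 𝓝[≠] 1, ‖(z − 1)•F_T z‖ ≤ C` (paid by β3 from FILE α's ρ₀ = 1 heads); `exists_L2Residue_cm_two` — the residue class itself, with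
  its a.e. identification `Res_T =ᵐ (x ↦ F x̃⁻¹ 1 − 𝟙[T < w₁ x]·φ₀r)` (★ p859977 §3).
HONEST LABEL: HC_CM is proved only modulo the 7 printed citations (2 remaining named inputs: hLiu418 = `stmt-HodgeConjecture-24832`, h413 = `stmt-HodgeConjecture-24833`) until rung 0
closes; this file asserts no named fact and closes no socket; remaining visible letters of §2: EXPORTS₂ (E1)(E2)(E2-bd)(E4)(E3′)₂, (F), `hcres`, the operator road's `(F_T, hFd, hFam)` and
(MS-1).
References: [MoeglinWaldspurger1995] IV.1.9–IV.1.11 · [BernsteinLapid2019] §4 p. 10 · [Langlands1976] §7.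
-/

set_option autoImplicit false
-- the mandated namespace repeats the single-problem summit's segment (`HodgeConjecture.HodgeConjecture`)
set_option linter.dupNamespace false

noncomputable section

open MeasureTheory Measure NumberField IsDedekindDomain Set Filter Topology Metric
open scoped ENNReal NNReal
open Literature.NumberTheory.Automorphic Literature.NumberTheory.Automorphic.UnitaryGroup AdelicGroupData
open Summit.HodgeConjecture.HodgeConjecture.Cruxes.H413.K2E1BorelEisensteinU
open Summit.HodgeConjecture.HodgeConjecture.Cruxes.H413.K2E1BLBorelSpacesU2Defs
open Summit.HodgeConjecture.HodgeConjecture.Cruxes.H413.K2E1BLRemovablePolesU (exists_analyticAt_eventuallyEq_of_differentiableAt_of_eventually_norm_le)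
open Summit.HodgeConjecture.HodgeConjecture.Cruxes.H413.K2E1ContinuedEisensteinResidueFunctionUTwo (ae_eq_residueValue_sub_indicator)
open Summit.HodgeConjecture.HodgeConjecture.Cruxes.H413.K2E1SphericalEisensteinResidueCuspidalCMTwo (residueValue_eq_const_cm_two exists_analyticAt_remainder_cm_two)

namespace Summit.HodgeConjecture.HodgeConjecture.Cruxes.H413.K2E1SphericalEisensteinL2ResidueCMTwo

/-! ## §1 A Banach-valued family with `‖(z − z₁)•F z‖` bounded near `z₁` has an (`L²`-)residue -/

section Banach

variable {X : Type*} [NormedAddCommGroup X] [NormedSpace ℂ X] [CompleteSpace X]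

/-- **THE RESIDUE OF A BANACH-VALUED FAMILY WITH AT MOST A SIMPLE POLE EXISTS**: if `F : ℂ → X` is differentiable on a punctured neighbourhood of `z₁` and `‖(z − z₁)•F z‖ ≤ C` there,
then `(z − z₁)•F z → Res` for some `Res ∈ X` (`z → z₁`, `z ≠ z₁`) — Riemann's removable-singularity theorem for `z ↦ (z − z₁)•F z` (★ brick), then continuity of the extension.
[cite: MoeglinWaldspurger1995, IV.1.9] [cite: BernsteinLapid2019, §4 p. 10] -/
theorem exists_tendsto_sub_smul_of_eventually_norm_le {F : ℂ → X} {z₁ : ℂ} (hd : ∀ᶠ z in 𝓝[≠] z₁, DifferentiableAt ℂ F z)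
    (hb : ∃ C : ℝ, ∀ᶠ z in 𝓝[≠] z₁, ‖(z - z₁) • F z‖ ≤ C) :
    ∃ Res : X, Tendsto (fun z : ℂ => (z - z₁) • F z) (𝓝[≠] z₁) (𝓝 Res) := by
  have hd' : ∀ᶠ z in 𝓝[≠] z₁, DifferentiableAt ℂ (fun z : ℂ => (z - z₁) • F z) z :=
    hd.mono fun z hz => (differentiableAt_id.sub (differentiableAt_const _)).smul hz
  obtain ⟨G, hGa, hGF⟩ := exists_analyticAt_eventuallyEq_of_differentiableAt_of_eventually_norm_le hd' hb
  exact ⟨G z₁, (tendsto_nhdsWithin_of_tendsto_nhds hGa.continuousAt.tendsto).congr' hGF⟩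

/-- The same from the operator road's shape: `F` differentiable on an OPEN `D` containing a punctured neighbourhood of `z₁`. [cite: MoeglinWaldspurger1995, IV.1.9] -/
theorem exists_tendsto_sub_smul_of_differentiableOn {F : ℂ → X} {z₁ : ℂ} {D : Set ℂ} (hDo : IsOpen D) (hD : ∀ᶠ z in 𝓝[≠] z₁, z ∈ D) (hFd : DifferentiableOn ℂ F D)
    (hb : ∃ C : ℝ, ∀ᶠ z in 𝓝[≠] z₁, ‖(z - z₁) • F z‖ ≤ C) :
    ∃ Res : X, Tendsto (fun z : ℂ => (z - z₁) • F z) (𝓝[≠] z₁) (𝓝 Res) :=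
  exists_tendsto_sub_smul_of_eventually_norm_le (hD.mono fun _ hz => hFd.differentiableAt (hDo.mem_nhds hz)) hb

end Banach

/-! ## §2 `U(1,1)∕CM`: the `L²` residue of the truncated spherical Eisenstein family, and ★ p860098 with `(Res, hRes)` discharged by (MS-1) -/

section CM

variable (L : Type) [Field L] [NumberField L] [IsCMField L]
variable [MeasurableSpace (quasiSplit (↥(maximalRealSubfield L)) L (IsCMField.complexConj L) 2).Adelic] [BorelSpace (quasiSplit (↥(maximalRealSubfield L)) L (IsCMField.complexConj L) 2).Adelic]

/-- **THE `L²` RESIDUE CLASS OF THE TRUNCATED SPHERICAL EISENSTEIN FAMILY OF `U(1,1)` AT `z = 1` EXISTS AND IS `Res Ẽ − φ₀r·𝟙_{T<w₁}` A.E.**: for the operator road's family `F_T : ℂ → L²(μ)`,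
holomorphic on an open `D ⊇ B(1,ρ)∖{1}` with `F_T(z) =ᵐ Λ^T Ẽ(z)`, the Maass–Selberg letter (MS-1) `‖(z − 1)•F_T z‖ ≤ C` near `1` gives `Res_T := lim (z − 1)•F_T(z)` in `L²(μ)` (§1), and ★
p859977 §3 identifies it: `Res_T(x) = F x̃⁻¹ 1 − 𝟙[T < w₁ x]·φ₀r` for a.e. `x` (letters: `G(F)`-invariance `hEcinv`, (E3′)₂ `hE3`, `hcres`, the pole letter (F) `hF hFE`).
[cite: MoeglinWaldspurger1995, IV.1.9–IV.1.11] [cite: BernsteinLapid2019, §4 p. 10] -/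
theorem exists_L2Residue_cm_two
    (μ : Measure (quasiSplit (↥(maximalRealSubfield L)) L (IsCMField.complexConj L) 2).automorphicQuotient)
    (ν : Measure ↥(adelicUnipotent (↥(maximalRealSubfield L)) L (IsCMField.complexConj L) 2)) [ν.IsHaarMeasure]
    {𝓕 : Set ↥(adelicUnipotent (↥(maximalRealSubfield L)) L (IsCMField.complexConj L) 2)}
    (h𝓕N : IsFundamentalDomain ↥(rationalUnipotent (↥(maximalRealSubfield L)) L (IsCMField.complexConj L) 2) 𝓕 ν) {T : ℝ≥0} (hT : 1 ≤ T) (φ₀ : ℂ)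
    (Ec : ℂ → (quasiSplit (↥(maximalRealSubfield L)) L (IsCMField.complexConj L) 2).Adelic → ℂ) {D : Set ℂ} (hDo : IsOpen D) {ρ : ℝ} (hρ : 0 < ρ) (hρD : ∀ z : ℂ, z ≠ 1 → dist z 1 < ρ → z ∈ D)
    (hEcinv : ∀ z ∈ D, ∀ (γ : (quasiSplit (↥(maximalRealSubfield L)) L (IsCMField.complexConj L) 2).arithmeticSubgroup) (x : (quasiSplit (↥(maximalRealSubfield L)) L (IsCMField.complexConj L) 2).Adelic),
      Ec z ((γ : (quasiSplit (↥(maximalRealSubfield L)) L (IsCMField.complexConj L) 2).Adelic) * x) = Ec z x)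
    {cc : ℂ → ℂ} {r : ℂ} (hcres : Tendsto (fun z : ℂ => (z - 1) * cc z) (𝓝[≠] 1) (𝓝 r))
    (hE3 : ∀ z ∈ D, ∀ g : (quasiSplit (↥(maximalRealSubfield L)) L (IsCMField.complexConj L) 2).Adelic,
      borelConstantTerm ν 𝓕 (Ec z) g = φ₀ * ((((borelHeight g : ℝ≥0) : ℝ) : ℂ) ^ z + cc z * (((borelHeight g : ℝ≥0) : ℝ) : ℂ) ^ (1 - z)))
    (Fp : (quasiSplit (↥(maximalRealSubfield L)) L (IsCMField.complexConj L) 2).Adelic → ℂ → ℂ) (hF : ∀ g, AnalyticAt ℂ (Fp g) 1) (hFE : ∀ g, Fp g =ᶠ[𝓝[≠] 1] fun z => (z - 1) * Ec z g)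
    (Fam : ℂ → (quasiSplit (↥(maximalRealSubfield L)) L (IsCMField.complexConj L) 2).L2 μ) (hFd : DifferentiableOn ℂ Fam D)
    (hFam : ∀ z ∈ D, ((Fam z : (quasiSplit (↥(maximalRealSubfield L)) L (IsCMField.complexConj L) 2).L2 μ) : (quasiSplit (↥(maximalRealSubfield L)) L (IsCMField.complexConj L) 2).automorphicQuotient → ℂ) =ᵐ[μ]
      (quasiSplit (↥(maximalRealSubfield L)) L (IsCMField.complexConj L) 2).quotFun (truncation ν 𝓕 T (Ec z)))
    (hMS1 : ∃ C : ℝ, ∀ᶠ z in 𝓝[≠] (1 : ℂ), ‖(z - 1) • Fam z‖ ≤ C) :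
    ∃ Res : (quasiSplit (↥(maximalRealSubfield L)) L (IsCMField.complexConj L) 2).L2 μ, Tendsto (fun z : ℂ => (z - 1) • Fam z) (𝓝[≠] 1) (𝓝 Res) ∧
      ((Res : (quasiSplit (↥(maximalRealSubfield L)) L (IsCMField.complexConj L) 2).L2 μ) : (quasiSplit (↥(maximalRealSubfield L)) L (IsCMField.complexConj L) 2).automorphicQuotient → ℂ) =ᵐ[μ] fun x =>
        Fp (Quotient.out (x : (quasiSplit (↥(maximalRealSubfield L)) L (IsCMField.complexConj L) 2).Adelic ⧸ (quasiSplit (↥(maximalRealSubfield L)) L (IsCMField.complexConj L) 2).quotientSubgroup))⁻¹ 1 -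
          if T < supHeight (↥(maximalRealSubfield L)) L (IsCMField.complexConj L) 2 x then φ₀ * r else 0 := by
  have hD1 : ∀ᶠ z in 𝓝[≠] (1 : ℂ), z ∈ D := by
    filter_upwards [inter_mem_nhdsWithin _ (ball_mem_nhds (1 : ℂ) hρ)] with z hz
    exact hρD z hz.1 (mem_ball.1 hz.2)
  obtain ⟨Res, hRes⟩ := exists_tendsto_sub_smul_of_differentiableOn hDo hD1 hFd hMS1
  exact ⟨Res, hRes, ae_eq_residueValue_sub_indicator μ ν h𝓕N hT φ₀ Ec hD1 hEcinv hcres hE3 Fp hF hFE Fam hFam Res hRes⟩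

/-- **THE RESIDUE AT `z = 1` IS THE CONSTANT `φ₀·r`, WITH `(Res, hRes)` DISCHARGED BY (MS-1)**: ★ `residueValue_eq_const_cm_two` (p860098) with its last two binders `(Res) (hRes)` replaced
by the single Maass–Selberg letter `hMS1 : ∃ C, ∀ᶠ z in 𝓝[≠] 1, ‖(z − 1)•F_T z‖ ≤ C` (§1 supplies the `L²` residue).  All other binders VERBATIM.
[cite: MoeglinWaldspurger1995, IV.1.11] [cite: Langlands1976, §7] [cite: BernsteinLapid2019, §4 p. 10] -/
theorem residueValue_eq_const_cm_two_of_ms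
    (μ : Measure (quasiSplit (↥(maximalRealSubfield L)) L (IsCMField.complexConj L) 2).automorphicQuotient) [(quasiSplit (↥(maximalRealSubfield L)) L (IsCMField.complexConj L) 2).IsAutomorphicMeasure μ]
    (ν : Measure ↥(adelicUnipotent (↥(maximalRealSubfield L)) L (IsCMField.complexConj L) 2)) [ν.IsHaarMeasure]
    {𝓕 : Set ↥(adelicUnipotent (↥(maximalRealSubfield L)) L (IsCMField.complexConj L) 2)}
    (h𝓕N : IsFundamentalDomain ↥(rationalUnipotent (↥(maximalRealSubfield L)) L (IsCMField.complexConj L) 2) 𝓕 ν) (h𝓕c : IsCompact (closure 𝓕))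
    (φ₀ : ℂ) {T : ℝ≥0} (hT : 1 ≤ T)
    (Ec : ℂ → (quasiSplit (↥(maximalRealSubfield L)) L (IsCMField.complexConj L) 2).Adelic → ℂ) {D : Set ℂ} (hDo : IsOpen D) (hDc : IsPreconnected D)
    {σ₀ : ℝ} (hσ₀ : 1 < σ₀) (hσD : ∀ᶠ z in 𝓝 ((σ₀ : ℝ) : ℂ), z ∈ D) {ρ : ℝ} (hρ : 0 < ρ) (hρD : ∀ z : ℂ, z ≠ 1 → dist z 1 < ρ → z ∈ D)
    (hEd : ∀ g, DifferentiableOn ℂ (fun z => Ec z g) D) (hE4 : ∀ z ∈ D, Continuous (Ec z))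
    (hEbd : ∀ z₀ ∈ D, ∀ K : Set (quasiSplit (↥(maximalRealSubfield L)) L (IsCMField.complexConj L) 2).Adelic, IsCompact K → ∃ V ∈ 𝓝 z₀, ∃ M : ℝ, ∀ z ∈ V, ∀ g ∈ K, ‖Ec z g‖ ≤ M)
    (hEcinv : ∀ z ∈ D, ∀ (γ : (quasiSplit (↥(maximalRealSubfield L)) L (IsCMField.complexConj L) 2).arithmeticSubgroup) (x : (quasiSplit (↥(maximalRealSubfield L)) L (IsCMField.complexConj L) 2).Adelic),
      Ec z ((γ : (quasiSplit (↥(maximalRealSubfield L)) L (IsCMField.complexConj L) 2).Adelic) * x) = Ec z x)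
    (hE2 : ∀ z ∈ D, 1 < z.re → Ec z = eisensteinSeriesU (flatSectionU (fun _ : (quasiSplit (↥(maximalRealSubfield L)) L (IsCMField.complexConj L) 2).Adelic => φ₀) z))
    {cc : ℂ → ℂ} {r : ℂ} (hcres : Tendsto (fun z : ℂ => (z - 1) * cc z) (𝓝[≠] 1) (𝓝 r))
    (hE3 : ∀ z ∈ D, ∀ g : (quasiSplit (↥(maximalRealSubfield L)) L (IsCMField.complexConj L) 2).Adelic,
      borelConstantTerm ν 𝓕 (Ec z) g = φ₀ * ((((borelHeight g : ℝ≥0) : ℝ) : ℂ) ^ z + cc z * (((borelHeight g : ℝ≥0) : ℝ) : ℂ) ^ (1 - z)))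
    (Fp : (quasiSplit (↥(maximalRealSubfield L)) L (IsCMField.complexConj L) 2).Adelic → ℂ → ℂ) (hF : ∀ g, AnalyticAt ℂ (Fp g) 1) (hFE : ∀ g, Fp g =ᶠ[𝓝[≠] 1] fun z => (z - 1) * Ec z g)
    (Fam : ℂ → (quasiSplit (↥(maximalRealSubfield L)) L (IsCMField.complexConj L) 2).L2 μ) (hFd : DifferentiableOn ℂ Fam D)
    (hFam : ∀ z ∈ D, ((Fam z : (quasiSplit (↥(maximalRealSubfield L)) L (IsCMField.complexConj L) 2).L2 μ) : (quasiSplit (↥(maximalRealSubfield L)) L (IsCMField.complexConj L) 2).automorphicQuotient → ℂ) =ᵐ[μ]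
      (quasiSplit (↥(maximalRealSubfield L)) L (IsCMField.complexConj L) 2).quotFun (truncation ν 𝓕 T (Ec z)))
    (hMS1 : ∃ C : ℝ, ∀ᶠ z in 𝓝[≠] (1 : ℂ), ‖(z - 1) • Fam z‖ ≤ C) :
    ∀ g : (quasiSplit (↥(maximalRealSubfield L)) L (IsCMField.complexConj L) 2).Adelic, Fp g 1 = φ₀ * r := by
  have hD1 : ∀ᶠ z in 𝓝[≠] (1 : ℂ), z ∈ D := by
    filter_upwards [inter_mem_nhdsWithin _ (ball_mem_nhds (1 : ℂ) hρ)] with z hz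
    exact hρD z hz.1 (mem_ball.1 hz.2)
  obtain ⟨Res, hRes⟩ := exists_tendsto_sub_smul_of_differentiableOn hDo hD1 hFd hMS1
  exact residueValue_eq_const_cm_two L μ ν h𝓕N h𝓕c φ₀ hT Ec hDo hDc hσ₀ hσD hρ hρD hEd hE4 hEbd hEcinv hE2 hcres hE3 Fp hF hFE Fam hFd hFam Res hRes

/-- **THE (RES)₂ CONCLUSION OF ★ `hres_cm_two_of_letters`, WITH `(Res, hRes)` DISCHARGED BY (MS-1)**: ★ `exists_analyticAt_remainder_cm_two` (p860098) with its last two binders replaced by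
`hMS1`. [cite: MoeglinWaldspurger1995, IV.1.11] [cite: Langlands1976, §7] -/
theorem exists_analyticAt_remainder_cm_two_of_ms
    (μ : Measure (quasiSplit (↥(maximalRealSubfield L)) L (IsCMField.complexConj L) 2).automorphicQuotient) [(quasiSplit (↥(maximalRealSubfield L)) L (IsCMField.complexConj L) 2).IsAutomorphicMeasure μ]
    (ν : Measure ↥(adelicUnipotent (↥(maximalRealSubfield L)) L (IsCMField.complexConj L) 2)) [ν.IsHaarMeasure]
    {𝓕 : Set ↥(adelicUnipotent (↥(maximalRealSubfield L)) L (IsCMField.complexConj L) 2)}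
    (h𝓕N : IsFundamentalDomain ↥(rationalUnipotent (↥(maximalRealSubfield L)) L (IsCMField.complexConj L) 2) 𝓕 ν) (h𝓕c : IsCompact (closure 𝓕))
    (φ₀ : ℂ) {T : ℝ≥0} (hT : 1 ≤ T)
    (Ec : ℂ → (quasiSplit (↥(maximalRealSubfield L)) L (IsCMField.complexConj L) 2).Adelic → ℂ) {D : Set ℂ} (hDo : IsOpen D) (hDc : IsPreconnected D)
    {σ₀ : ℝ} (hσ₀ : 1 < σ₀) (hσD : ∀ᶠ z in 𝓝 ((σ₀ : ℝ) : ℂ), z ∈ D) {ρ : ℝ} (hρ : 0 < ρ) (hρD : ∀ z : ℂ, z ≠ 1 → dist z 1 < ρ → z ∈ D)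
    (hEd : ∀ g, DifferentiableOn ℂ (fun z => Ec z g) D) (hE4 : ∀ z ∈ D, Continuous (Ec z))
    (hEbd : ∀ z₀ ∈ D, ∀ K : Set (quasiSplit (↥(maximalRealSubfield L)) L (IsCMField.complexConj L) 2).Adelic, IsCompact K → ∃ V ∈ 𝓝 z₀, ∃ M : ℝ, ∀ z ∈ V, ∀ g ∈ K, ‖Ec z g‖ ≤ M)
    (hEcinv : ∀ z ∈ D, ∀ (γ : (quasiSplit (↥(maximalRealSubfield L)) L (IsCMField.complexConj L) 2).arithmeticSubgroup) (x : (quasiSplit (↥(maximalRealSubfield L)) L (IsCMField.complexConj L) 2).Adelic),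
      Ec z ((γ : (quasiSplit (↥(maximalRealSubfield L)) L (IsCMField.complexConj L) 2).Adelic) * x) = Ec z x)
    (hE2 : ∀ z ∈ D, 1 < z.re → Ec z = eisensteinSeriesU (flatSectionU (fun _ : (quasiSplit (↥(maximalRealSubfield L)) L (IsCMField.complexConj L) 2).Adelic => φ₀) z))
    {cc : ℂ → ℂ} {r : ℂ} (hchol : DifferentiableOn ℂ cc ({z : ℂ | 1 / 2 < z.re} \ {1})) (hcres : Tendsto (fun z : ℂ => (z - 1) * cc z) (𝓝[≠] 1) (𝓝 r))
    (hE3 : ∀ z ∈ D, ∀ g : (quasiSplit (↥(maximalRealSubfield L)) L (IsCMField.complexConj L) 2).Adelic,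
      borelConstantTerm ν 𝓕 (Ec z) g = φ₀ * ((((borelHeight g : ℝ≥0) : ℝ) : ℂ) ^ z + cc z * (((borelHeight g : ℝ≥0) : ℝ) : ℂ) ^ (1 - z)))
    (Fp : (quasiSplit (↥(maximalRealSubfield L)) L (IsCMField.complexConj L) 2).Adelic → ℂ → ℂ) (hF : ∀ g, AnalyticAt ℂ (Fp g) 1) (hFE : ∀ g, Fp g =ᶠ[𝓝[≠] 1] fun z => (z - 1) * Ec z g)
    (Fam : ℂ → (quasiSplit (↥(maximalRealSubfield L)) L (IsCMField.complexConj L) 2).L2 μ) (hFd : DifferentiableOn ℂ Fam D)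
    (hFam : ∀ z ∈ D, ((Fam z : (quasiSplit (↥(maximalRealSubfield L)) L (IsCMField.complexConj L) 2).L2 μ) : (quasiSplit (↥(maximalRealSubfield L)) L (IsCMField.complexConj L) 2).automorphicQuotient → ℂ) =ᵐ[μ]
      (quasiSplit (↥(maximalRealSubfield L)) L (IsCMField.complexConj L) 2).quotFun (truncation ν 𝓕 T (Ec z)))
    (hMS1 : ∃ C : ℝ, ∀ᶠ z in 𝓝[≠] (1 : ℂ), ‖(z - 1) • Fam z‖ ≤ C) :
    ∀ g : (quasiSplit (↥(maximalRealSubfield L)) L (IsCMField.complexConj L) 2).Adelic, ∃ G : ℂ → ℂ, AnalyticAt ℂ G 1 ∧ G =ᶠ[𝓝[≠] 1] (fun z => Ec z g -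
      φ₀ * ((((borelHeight g : ℝ≥0) : ℝ) : ℂ) ^ z + cc z * (((borelHeight g : ℝ≥0) : ℝ) : ℂ) ^ ((1 : ℂ) - z))) := by
  have hD1 : ∀ᶠ z in 𝓝[≠] (1 : ℂ), z ∈ D := by
    filter_upwards [inter_mem_nhdsWithin _ (ball_mem_nhds (1 : ℂ) hρ)] with z hz
    exact hρD z hz.1 (mem_ball.1 hz.2)
  obtain ⟨Res, hRes⟩ := exists_tendsto_sub_smul_of_differentiableOn hDo hD1 hFd hMS1
  exact exists_analyticAt_remainder_cm_two L μ ν h𝓕N h𝓕c φ₀ hT Ec hDo hDc hσ₀ hσD hρ hρD hEd hE4 hEbd hEcinv hE2 hchol hcres hE3 Fp hF hFE Fam hFd hFam Res hRes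

end CM

end Summit.HodgeConjecture.HodgeConjecture.Cruxes.H413.K2E1SphericalEisensteinL2ResidueCMTwo

end
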